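import Summits.Ventures.HSemireg.WedgeHankelRecurrenceGaussChebyshevCovariance

/-!
# Venture HSemireg — **A. MARKOV'S THEOREM ON THE MONOTONE DEPENDENCE OF THE GAUSS NODES ON THE MEASURE (DISCRETE FORM)**: if `ν' = g·ν` on the same nodes with a density `g > 0` that is
# non-decreasing along the nodes, then EVERY Gauss node moves to the right, `x_k(ν) ≤ x_k(gν)` (`k = 0, …, t`), strictly if `g` is strictly increasing and the measure has at least `t + 2`
# points — proved WITHOUT differentiation, by an explicit test polynomial and the weighted Chebyshev inequality

HONEST FRAMING. Part of the Lean index of the computation cell `pub-hsemireg` (seat p10 gen 44, Sunday typer «UNIFORM-IN-n»).  Finite sums of real numbers and real polynomials only; no variety,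
no cohomology theory, no sheaf, no Ext group and no semiregularity map is constructed here; nothing here says that HC / HC_CM / HC_AV holds; no Literature fact (unproved `Prop`) is declared or
used.  Custodian versions as in `WedgeHankelSiegelIdeal` (1/3).
SOURCES (cited).  A. Markov, *Sur les racines de certaines équations (second note)*, Math. Ann. 27 (1886) 177–182; G. Szegő, *Orthogonal Polynomials*, Thm 6.12.1 ∕ 6.12.2 (Markov's theorem:
the zeros of `p_n(w(·, τ); x)` increase with `τ` when `∂_τ log w(x, τ)` increases in `x`); M. E. H. Ismail, *Classical and Quantum Orthogonal Polynomials in One Variable* (2005) §7.1;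
G. Freud, *Orthogonal Polynomials* (1971) Problem III.16.  The printed theorem is differential (a one-parameter family of weights); the statement typed here is its two-measure («integrated»)
form for discrete measures, which implies the monotonicity along any family `τ ↦ g_τ ν` with `g_τ ∕ g_σ` non-decreasing for `σ ≤ τ`.
PROOF TYPED HERE (no calculus).  For the `k`-th node put `T = ∏_{j<k}(X − x_j)·∏_{j>k}(X − y_j)` (`deg T = t`).  By Gauss exactness for `ν` (degree `2t + 1`), `Σ ν w T² − x_k Σ ν T² = Σ_j μ_j (x_j − x_k)
T(x_j)² ≥ 0` (the terms `j < k` vanish); likewise `Σ gν w T² ≤ y_k Σ gν T²`; the weighted Chebyshev inequality (N319) gives `(Σ gν T²)(Σ ν w T²) ≤ (Σ ν T²)(Σ gν w T²)`; chaining,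
`x_k (Σ ν T²)(Σ gν T²) ≤ y_k (Σ ν T²)(Σ gν T²)` with both sums positive.  Strictness: two nodes off the `t` roots of `T` give a strictly positive Chebyshev term.
DEDUP DISCLOSURE (`rg -n 'markov_monotone|monotone_density|Markov.s theorem|zeros increase' Summits/Ventures/HSemireg Literature`, 2026-09-03): the tree has the monotonicity of the EXTREME nodes
in the DEGREE (N301 `gaussNode_extreme_mono`) and the interlacing under a LINEAR factor (N268 `gauss_kernel_nodes_interlace`, N267 `gauss_nodes_interlace_stieltjes`); the dependence on a
general monotone density is new.  The 6 names below: 0 hits tree-wide.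

WHAT IS IN THE TREE.  N263 `sum_mul_eval_eq_of_moments_eq` (exactness by moments), N265 `gauss_weight_nonneg`, N273 `sum_mul_eval_sq_pos_of_natDegree_lt`, N319 `rayleigh_num_mul_le_of_monotone_density`,
`weighted_chebyshev_sum_lt`, `similarly_ordered_of_monotone_along`.
THIS FILE (namespace `Summit.Ventures.HSemireg.Wedge.HankelOuter` continued; CHAINED on N319 (import), N263, N265, N273; 0 definitions):
* §1085 `markov_testPoly_spec` (the test polynomial: monic, degree `t`, its zeros), `gaussNode_mul_sum_sq_le_of_eval_eq_zero_below` (`P(x_j) = 0 ∀ j < k ⇒ x_k Σ ν P² ≤ Σ ν w P²`),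
  `sum_node_sq_le_gaussNode_mul_of_eval_eq_zero_above` (`P(x_j) = 0 ∀ j > k ⇒ Σ ν w P² ≤ x_k Σ ν P²`), `exists_two_nodes_eval_ne_zero` (`N ≥ d + 2` distinct nodes, `deg T ≤ d`, `T ≠ 0` ⇒ two
  nodes off the roots), **`markov_monotone`** (`x_k ≤ y_k` for every `k`), **`markov_strictMono`** (`x_k < y_k`, `g` strictly increasing along `w`, `N ≥ t + 2`).
CAVEATS.  Discrete positive measures on finitely many nodes; both rules are the `(t+1)`-point Gauss rules (moments to degree `2t + 1`); «non-decreasing along `w`» is `w l < w l' → g l ≤ g l'`.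
Nothing Ext-side.  New names only.
-/

open Module Polynomial
open scoped Matrix Polynomial

namespace Summit.Ventures.HSemireg.Wedge.HankelOuter

/-! ## §1085. A. Markov's theorem: the Gauss nodes are monotone in the measure -/

/-- **THE TEST POLYNOMIAL `T_k = ∏_{j ≠ k}(X − c_j)`, `c_j = x_j` (`j < k`), `= y_j` (`j > k`)**: monic, of degree `t`, vanishing at `x_j` (`j < k`) and at `y_j` (`j > k`). [this file, §1085] -/
theorem markov_testPoly_spec {t : ℕ} (x y : Fin (t + 1) → ℝ) (k : Fin (t + 1)) :
    (∏ j ∈ Finset.univ.erase k, (Polynomial.X - C (if j < k then x j else y j))).Monic ∧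
      (∏ j ∈ Finset.univ.erase k, (Polynomial.X - C (if j < k then x j else y j))).natDegree = t ∧
      (∀ j, j < k → (∏ j ∈ Finset.univ.erase k, (Polynomial.X - C (if j < k then x j else y j))).eval (x j) = 0) ∧
      ∀ j, k < j → (∏ j ∈ Finset.univ.erase k, (Polynomial.X - C (if j < k then x j else y j))).eval (y j) = 0 := by
  refine ⟨monic_prod_of_monic _ _ fun j _ => monic_X_sub_C _, ?_, fun j hj => ?_, fun j hj => ?_⟩
  · rw [natDegree_prod_of_monic _ _ (fun j _ => monic_X_sub_C _)]
    simp only [natDegree_X_sub_C, Finset.sum_const, Finset.card_erase_of_mem (Finset.mem_univ k), Finset.card_univ, Fintype.card_fin, smul_eq_mul,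
      mul_one, Nat.add_sub_cancel]
  · rw [eval_prod]
    exact Finset.prod_eq_zero (Finset.mem_erase.2 ⟨hj.ne, Finset.mem_univ j⟩) (by rw [if_pos hj, eval_sub, eval_X, eval_C, sub_self])
  · rw [eval_prod]
    exact Finset.prod_eq_zero (Finset.mem_erase.2 ⟨hj.ne', Finset.mem_univ j⟩) (by rw [if_neg (not_lt.2 hj.le), eval_sub, eval_X, eval_C, sub_self])

/-- **LOWER RAYLEIGH BOUND AT A GAUSS RULE: `P(x_j) = 0` for all `j < k` and `deg P ≤ t` ⇒ `x_k Σ_l ν_l P(w_l)² ≤ Σ_l ν_l w_l P(w_l)²`** (`μ ≥ 0`; by exactness both sides live on the nodes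
`x_j`, `j ≥ k`). [Szegő §3.4 ∕ §6.12; this file, §1085] -/
theorem gaussNode_mul_sum_sq_le_of_eval_eq_zero_below {t N : ℕ} {μ x : Fin (t + 1) → ℝ} {ν w : Fin N → ℝ} (hx : StrictMono x) (hμ : ∀ j, 0 ≤ μ j)
    (hmom : ∀ p, p ≤ 2 * t + 1 → ∑ j, μ j * x j ^ p = ∑ l, ν l * w l ^ p) {P : ℝ[X]} (hP : P.natDegree ≤ t) (k : Fin (t + 1))
    (hPx : ∀ j, j < k → P.eval (x j) = 0) :
    x k * ∑ l, ν l * (P.eval (w l)) ^ 2 ≤ ∑ l, ν l * (w l * (P.eval (w l)) ^ 2) := by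
  have hmom' : ∀ p, p < 2 * t + 2 → ∑ j, μ j * x j ^ p = ∑ l, ν l * w l ^ p := fun p hp => hmom p (by omega)
  have hA : ∑ l, ν l * (P.eval (w l)) ^ 2 = ∑ j, μ j * (P.eval (x j)) ^ 2 := by
    have h := sum_mul_eval_eq_of_moments_eq hmom' (F := P ^ 2) (natDegree_pow_le.trans_lt (by omega))
    simp only [eval_pow] at h
    exact h.symm
  have hB : ∑ l, ν l * (w l * (P.eval (w l)) ^ 2) = ∑ j, μ j * (x j * (P.eval (x j)) ^ 2) := by
    have h := sum_mul_eval_eq_of_moments_eq hmom' (F := Polynomial.X * P ^ 2)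
      ((natDegree_mul_le.trans (add_le_add natDegree_X_le natDegree_pow_le)).trans_lt (by omega))
    simp only [eval_mul, eval_X, eval_pow] at h
    exact h.symm
  rw [hA, hB, Finset.mul_sum, ← sub_nonneg, ← Finset.sum_sub_distrib]
  refine Finset.sum_nonneg fun j _ => ?_
  rw [show μ j * (x j * (P.eval (x j)) ^ 2) - x k * (μ j * (P.eval (x j)) ^ 2) = μ j * ((x j - x k) * (P.eval (x j)) ^ 2) by ring]
  rcases lt_or_ge j k with hjk | hjk
  · rw [hPx j hjk, sq, mul_zero, mul_zero, mul_zero]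
  · exact mul_nonneg (hμ j) (mul_nonneg (sub_nonneg.2 (hx.monotone hjk)) (sq_nonneg _))

/-- **UPPER RAYLEIGH BOUND AT A GAUSS RULE: `P(x_j) = 0` for all `j > k` and `deg P ≤ t` ⇒ `Σ_l ν_l w_l P(w_l)² ≤ x_k Σ_l ν_l P(w_l)²`** (`μ ≥ 0`). [Szegő §3.4 ∕ §6.12; this file, §1085] -/
theorem sum_node_sq_le_gaussNode_mul_of_eval_eq_zero_above {t N : ℕ} {μ x : Fin (t + 1) → ℝ} {ν w : Fin N → ℝ} (hx : StrictMono x) (hμ : ∀ j, 0 ≤ μ j)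
    (hmom : ∀ p, p ≤ 2 * t + 1 → ∑ j, μ j * x j ^ p = ∑ l, ν l * w l ^ p) {P : ℝ[X]} (hP : P.natDegree ≤ t) (k : Fin (t + 1))
    (hPx : ∀ j, k < j → P.eval (x j) = 0) :
    ∑ l, ν l * (w l * (P.eval (w l)) ^ 2) ≤ x k * ∑ l, ν l * (P.eval (w l)) ^ 2 := by
  have hmom' : ∀ p, p < 2 * t + 2 → ∑ j, μ j * x j ^ p = ∑ l, ν l * w l ^ p := fun p hp => hmom p (by omega)
  have hA : ∑ l, ν l * (P.eval (w l)) ^ 2 = ∑ j, μ j * (P.eval (x j)) ^ 2 := by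
    have h := sum_mul_eval_eq_of_moments_eq hmom' (F := P ^ 2) (natDegree_pow_le.trans_lt (by omega))
    simp only [eval_pow] at h
    exact h.symm
  have hB : ∑ l, ν l * (w l * (P.eval (w l)) ^ 2) = ∑ j, μ j * (x j * (P.eval (x j)) ^ 2) := by
    have h := sum_mul_eval_eq_of_moments_eq hmom' (F := Polynomial.X * P ^ 2)
      ((natDegree_mul_le.trans (add_le_add natDegree_X_le natDegree_pow_le)).trans_lt (by omega))
    simp only [eval_mul, eval_X, eval_pow] at h
    exact h.symm
  rw [hA, hB, Finset.mul_sum, ← sub_nonneg, ← Finset.sum_sub_distrib]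
  refine Finset.sum_nonneg fun j _ => ?_
  rw [show x k * (μ j * (P.eval (x j)) ^ 2) - μ j * (x j * (P.eval (x j)) ^ 2) = μ j * ((x k - x j) * (P.eval (x j)) ^ 2) by ring]
  rcases lt_or_ge k j with hjk | hjk
  · rw [hPx j hjk, sq, mul_zero, mul_zero, mul_zero]
  · exact mul_nonneg (hμ j) (mul_nonneg (sub_nonneg.2 (hx.monotone hjk)) (sq_nonneg _))

/-- Among `N ≥ d + 2` distinct nodes at least two are NOT roots of a non-zero polynomial of degree `≤ d`. [bookkeeping; this file, §1085] -/
theorem exists_two_nodes_eval_ne_zero {N d : ℕ} {w : Fin N → ℝ} (hw : Function.Injective w) (hN : d + 2 ≤ N) {T : ℝ[X]} (hT : T ≠ 0) (hTd : T.natDegree ≤ d) :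
    ∃ l₀ l₁, l₀ ≠ l₁ ∧ T.eval (w l₀) ≠ 0 ∧ T.eval (w l₁) ≠ 0 := by
  classical
  have hZc : (Finset.univ.filter (fun l : Fin N => T.eval (w l) = 0)).card ≤ d := by
    have h1 : ((Finset.univ.filter (fun l : Fin N => T.eval (w l) = 0)).image w).card = (Finset.univ.filter (fun l : Fin N => T.eval (w l) = 0)).card :=
      Finset.card_image_of_injective _ hw
    have h2 : (Finset.univ.filter (fun l : Fin N => T.eval (w l) = 0)).image w ⊆ T.roots.toFinset := by
      intro r hr
      obtain ⟨l, hl, rfl⟩ := Finset.mem_image.1 hr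
      rw [Multiset.mem_toFinset, mem_roots hT, IsRoot.def]
      exact (Finset.mem_filter.1 hl).2
    calc (Finset.univ.filter (fun l : Fin N => T.eval (w l) = 0)).card = ((Finset.univ.filter (fun l : Fin N => T.eval (w l) = 0)).image w).card := h1.symm
      _ ≤ T.roots.toFinset.card := Finset.card_le_card h2
      _ ≤ Multiset.card T.roots := Multiset.toFinset_card_le _
      _ ≤ T.natDegree := card_roots' T
      _ ≤ d := hTd
  have hC : 1 < (Finset.univ.filter (fun l : Fin N => ¬ T.eval (w l) = 0)).card := by
    have h := Finset.card_filter_add_card_filter_not (s := (Finset.univ : Finset (Fin N))) (fun l => T.eval (w l) = 0)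
    rw [Finset.card_univ, Fintype.card_fin] at h
    omega
  obtain ⟨l₀, l₁, hl₀, hl₁, hne⟩ := Finset.one_lt_card_iff.1 hC
  exact ⟨l₀, l₁, hne, (Finset.mem_filter.1 hl₀).2, (Finset.mem_filter.1 hl₁).2⟩

/-- **A. MARKOV'S THEOREM (discrete form, every node): if `g > 0` is non-decreasing along the nodes, the `(t+1)`-point Gauss rules `(μ, x)` of `ν` and `(μ', y)` of `gν` satisfy `x_k ≤ y_k`
for every `k`.** [Markov 1886; Szegő Thm 6.12.1–6.12.2; Ismail §7.1; this file, §1085] -/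
theorem markov_monotone {t N : ℕ} {ν w g : Fin N → ℝ} (hν : ∀ l, 0 < ν l) (hw : Function.Injective w) (hN : t + 1 ≤ N)
    (hg : ∀ l, 0 < g l) (hgw : ∀ l l', w l < w l' → g l ≤ g l')
    {μ x μ' y : Fin (t + 1) → ℝ} (hx : StrictMono x) (hy : StrictMono y)
    (hmom : ∀ p, p ≤ 2 * t + 1 → ∑ j, μ j * x j ^ p = ∑ l, ν l * w l ^ p)
    (hmom' : ∀ p, p ≤ 2 * t + 1 → ∑ j, μ' j * y j ^ p = ∑ l, (g l * ν l) * w l ^ p) (k : Fin (t + 1)) :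
    x k ≤ y k := by
  obtain ⟨hTm, hTd, hTx, hTy⟩ := markov_testPoly_spec x y k
  set T := ∏ j ∈ Finset.univ.erase k, (Polynomial.X - C (if j < k then x j else y j)) with hT
  have hμ : ∀ j, 0 ≤ μ j := gauss_weight_nonneg hx.injective (fun l => (hν l).le) (fun p hp => hmom p (by omega))
  have hμ' : ∀ j, 0 ≤ μ' j := gauss_weight_nonneg hy.injective (fun l => (mul_pos (hg l) (hν l)).le) (fun p hp => hmom' p (by omega))
  have hA : 0 < ∑ l, ν l * (T.eval (w l)) ^ 2 := sum_mul_eval_sq_pos_of_natDegree_lt hν hw hTm.ne_zero (by omega)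
  have hA' : 0 < ∑ l, (g l * ν l) * (T.eval (w l)) ^ 2 := sum_mul_eval_sq_pos_of_natDegree_lt (fun l => mul_pos (hg l) (hν l)) hw hTm.ne_zero (by omega)
  have h1 := gaussNode_mul_sum_sq_le_of_eval_eq_zero_below hx hμ hmom hTd.le k hTx
  have h2 := sum_node_sq_le_gaussNode_mul_of_eval_eq_zero_above hy hμ' hmom' hTd.le k hTy
  have h3 := rayleigh_num_mul_le_of_monotone_density (fun l => (hν l).le) hgw T
  set A := ∑ l, ν l * (T.eval (w l)) ^ 2 with hAdef
  set B := ∑ l, ν l * (w l * (T.eval (w l)) ^ 2) with hBdef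
  set A' := ∑ l, (g l * ν l) * (T.eval (w l)) ^ 2 with hA'def
  set B' := ∑ l, (g l * ν l) * (w l * (T.eval (w l)) ^ 2) with hB'def
  refine le_of_mul_le_mul_right ?_ (mul_pos hA hA')
  calc x k * (A * A') = (x k * A) * A' := by ring
    _ ≤ B * A' := mul_le_mul_of_nonneg_right h1 hA'.le
    _ = A' * B := mul_comm _ _
    _ ≤ A * B' := h3
    _ ≤ A * (y k * A') := mul_le_mul_of_nonneg_left h2 hA.le
    _ = y k * (A * A') := by ring

/-- **A. MARKOV'S THEOREM, STRICT FORM: if `g > 0` is STRICTLY increasing along the nodes and the measure has at least `t + 2` points, then `x_k < y_k` for every `k`.**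
[Markov 1886; Szegő Thm 6.12.2; this file, §1085] -/
theorem markov_strictMono {t N : ℕ} {ν w g : Fin N → ℝ} (hν : ∀ l, 0 < ν l) (hw : Function.Injective w) (hN : t + 2 ≤ N)
    (hg : ∀ l, 0 < g l) (hgw : ∀ l l', w l < w l' → g l < g l')
    {μ x μ' y : Fin (t + 1) → ℝ} (hx : StrictMono x) (hy : StrictMono y)
    (hmom : ∀ p, p ≤ 2 * t + 1 → ∑ j, μ j * x j ^ p = ∑ l, ν l * w l ^ p)
    (hmom' : ∀ p, p ≤ 2 * t + 1 → ∑ j, μ' j * y j ^ p = ∑ l, (g l * ν l) * w l ^ p) (k : Fin (t + 1)) :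
    x k < y k := by
  obtain ⟨hTm, hTd, hTx, hTy⟩ := markov_testPoly_spec x y k
  set T := ∏ j ∈ Finset.univ.erase k, (Polynomial.X - C (if j < k then x j else y j)) with hT
  have hgw' : ∀ l l', w l < w l' → g l ≤ g l' := fun l l' h => (hgw l l' h).le
  have hμ : ∀ j, 0 ≤ μ j := gauss_weight_nonneg hx.injective (fun l => (hν l).le) (fun p hp => hmom p (by omega))
  have hμ' : ∀ j, 0 ≤ μ' j := gauss_weight_nonneg hy.injective (fun l => (mul_pos (hg l) (hν l)).le) (fun p hp => hmom' p (by omega))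
  have hA : 0 < ∑ l, ν l * (T.eval (w l)) ^ 2 := sum_mul_eval_sq_pos_of_natDegree_lt hν hw hTm.ne_zero (by omega)
  have hA' : 0 < ∑ l, (g l * ν l) * (T.eval (w l)) ^ 2 := sum_mul_eval_sq_pos_of_natDegree_lt (fun l => mul_pos (hg l) (hν l)) hw hTm.ne_zero (by omega)
  have h1 := gaussNode_mul_sum_sq_le_of_eval_eq_zero_below hx hμ hmom hTd.le k hTx
  have h2 := sum_node_sq_le_gaussNode_mul_of_eval_eq_zero_above hy hμ' hmom' hTd.le k hTy
  -- strict Chebyshev: two nodes off the `t` roots of `T`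
  obtain ⟨l₀, l₁, hne, hl₀, hl₁⟩ := exists_two_nodes_eval_ne_zero hw hN hTm.ne_zero hTd.le
  have hwne : w l₀ ≠ w l₁ := fun h => hne (hw h)
  have hstrict : 0 < (g l₀ - g l₁) * (w l₀ - w l₁) := by
    rcases lt_or_gt_of_ne hwne with h | h
    · exact mul_pos_of_neg_of_neg (sub_neg.2 (hgw l₀ l₁ h)) (sub_neg.2 h)
    · exact mul_pos (sub_pos.2 (hgw l₁ l₀ h)) (sub_pos.2 h)
  have h3 := weighted_chebyshev_sum_lt (a := fun l => ν l * (T.eval (w l)) ^ 2) (f := g) (g := w) (fun l => mul_nonneg (hν l).le (sq_nonneg _))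
    (similarly_ordered_of_monotone_along hgw') (i₀ := l₀) (j₀ := l₁) (mul_pos (hν l₀) (sq_pos_iff.2 hl₀)) (mul_pos (hν l₁) (sq_pos_iff.2 hl₁)) hstrict
  have e1 : ∑ l, (g l * ν l) * (T.eval (w l)) ^ 2 = ∑ l, ν l * (T.eval (w l)) ^ 2 * g l := Finset.sum_congr rfl fun l _ => by ring
  have e2 : ∑ l, ν l * (w l * (T.eval (w l)) ^ 2) = ∑ l, ν l * (T.eval (w l)) ^ 2 * w l := Finset.sum_congr rfl fun l _ => by ring
  have e3 : ∑ l, (g l * ν l) * (w l * (T.eval (w l)) ^ 2) = ∑ l, ν l * (T.eval (w l)) ^ 2 * (g l * w l) := Finset.sum_congr rfl fun l _ => by ring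
  set A := ∑ l, ν l * (T.eval (w l)) ^ 2 with hAdef
  set B := ∑ l, ν l * (w l * (T.eval (w l)) ^ 2) with hBdef
  set A' := ∑ l, (g l * ν l) * (T.eval (w l)) ^ 2 with hA'def
  set B' := ∑ l, (g l * ν l) * (w l * (T.eval (w l)) ^ 2) with hB'def
  rw [← e1, ← e2, ← e3] at h3
  refine lt_of_mul_lt_mul_right ?_ (mul_pos hA hA').le
  calc x k * (A * A') = (x k * A) * A' := by ring
    _ ≤ B * A' := mul_le_mul_of_nonneg_right h1 hA'.le
    _ = A' * B := mul_comm _ _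
    _ < A * B' := h3
    _ ≤ A * (y k * A') := mul_le_mul_of_nonneg_left h2 hA.le
    _ = y k * (A * A') := by ring

end Summit.Ventures.HSemireg.Wedge.HankelOuter
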